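import Summits.QuantumFields.BalabanUV.Gaps.D1RoadsJunction
import Summits.QuantumFields.BalabanUV.Gaps.BetaContFromD4Chain
import Summits.QuantumFields.BalabanUV.Beta.FP.StepKernelWardDataRecord
import Summits.QuantumFields.BalabanUV.Beta.FP.StepRecursionFeedTabs

/-!
# `BalabanUV.Gaps.D1RoadsJunctionPinned` — cell `pub-balaban-gaps` (YM blitz Y1), track G1, seat g1-p1 (gen 2 draft, gen 3 filing): **THE JUNCTION RE-POINTED AFTER ROAD FP's #30 —
# at the (III′) literal of record under the locks, an4's `StepRecursion` of the kernels (ONE hypothesis) ∕ road FP's rows (L1)(L2′) + the `m = 1` anchor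
# ⟹ ( (D1) ⟺ THE ONE-SHOT LAW OF THE COMPOSITE FAMILY ); (L4′) (T0)(T1) no longer displayed**

HONEST FRAMING (page 1, cell contract).  WHAT THIS IS: [folklore] compositions BY NAME — road FP OWNER d1-p3's #30d `FP.StepKernelWardDataRecord` ((T0)(T1) of the (III′)
step kernels of record as THEOREMS under the locks: `stepT0_∕stepT1_JsB12CombShSym_an1S2_pinned`; `d1Tel_anchored_of_kernel_laws_wStep_pinned`,
`d1Tel_anchored_of_stepRecursion_wStep_pinned`) fed into this seat's `Gaps.D1RoadsJunction` §1 (`readoutBdd_of_D1Tel_T0T1`, `d1Drift_iff_oneShotLaw_of_readoutBdd`).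
WHAT THIS IS NOT: not a proof of (D1), of `D1Tel`, of the step recursion or of any kernel row; nothing of Bałaban's papers asserted ([B12] Thm 2 p. 259 printed WITHOUT
proof; [B16] p. 355); NOT `BetaPertH`, NOT continuum, NOT Clay.  HONEST DEPENDENCY (verbatim): continuum YM on T⁴ ⇐ BetaPertH ∧ nine spine estimates (0/9 proved);
BetaPertH ⇐ (D1) ∧ (D4) ∧ CAP+tail; G-an2-4 gates asym, D1 and NE2/3/4.

WHAT.  `Gaps.D1RoadsJunction.d1Drift_record_iff_oneShotLaw_of_fpRows` (p342971) displayed road FP's rows (L1)(L2′)(L4′) + anchor.  With #30d the (L4′) rows (T0)(T1) are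
theorems under M‴'s own scalars (`Odd Lc`, `2 ≤ Lc`, `2 ≤ N`, locks `hΛ hcB`), so:
* §1 **`d1Drift_record_iff_oneShotLaw_of_stepRecursion`** — under the locks, for ANY composite family `Jc` anchored on `JcOf` at `m = 1`: an4's
  `StepRecursion Lc (TbalOf Lc Js) (TshotOf Lc Jc) (wStep Lc)` (ONE kernel hypothesis = the step recursion of the Hessian kernels at the canonical weight) ⟹
  ( `D1Drift Lc Js Nc μ ν ⟺ OneShotLaw Lc Jc Nc μ ν` ), any colour numeral `Nc`, any `μ ν`; NO [B5] statement, NO label, NO window, NO symmetry letter.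
  In words: **given the step recursion of the kernels, binder (D1) at the literal of record IS the one-shot one-loop law of the composite family.**
* §1′ the same from road FP's DISPLAYED rows (L1) `hlaw` + (L2′) `hN hF hG` + anchor (`readoutBdd_record_of_fpRows_pinned`, `…_iff_oneShotLaw_of_fpRows_pinned`), (L4′) gone.
* §2 AT THE PINS `cΛ := 2/Lc⁴`, `cB := −Lc¹²/4` the locks are `lock_mul_pow` ∕ `rfl`: `d1Drift_pinned_iff_oneShotLaw_of_stepRecursion` displays `Odd Lc`, `2 ≤ Lc`, `2 ≤ N`, the anchor and
  `hrec` ONLY.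
* §3 the T⁴ headline with the β-side opened down to `hrec` + `OneShotLaw` + row (D4)'s `AtSlope` + (C); and (`…_atSlopeCont`) with (C) DERIVED from g1-p2's
  ONE residue `Gaps.BetaContFromD4Chain.AtSlopeCont` (p342809) and the colour numeral pinned to the gauge group — β-column = step recursion ∧ one-shot law ∧ (D4)+(C-pt) object;
  and the displayed-rows form `continuumYM4Torus_of_fpRows_pinned_oneShotLaw_atSlopeCont` (g1-plan-2 X-31, re-pointed: FP's rows (L1)(L2′) ∧ one-shot law ∧ `AtSlopeCont`).
0 rows discharged here ((T0)(T1) are #30d's theorems; the step recursion, the one-shot law, `AtSlope`, (C) stay hypotheses).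
* §4 (v1.1, APPEND-ONLY; every v1 declaration byte-identical) the junction at the `Jc` OF RECORD `JcOfTabs hLc N tabs cΛ cB` (an2 `Beta.CombOneShotJetsTabs`),
  CALLING road FP's #31 `Beta.FP.StepRecursionFeedTabs.d1Tel_JcOfTabs_of_stepRecursion_wStep_pinned` ∕ `…_of_kernel_laws_wStep_pinned` (nothing restated).

ABSOLUTE RULE (cell charter, verbatim): «No internally-minted statement may enter as a cited fact. Every hypothesis is either kernel-proved in this package or a
verbatim quotation of a PUBLISHED theorem with page reference.»  No `def`, no `def … : Prop`, nothing cited as mathematics, 0 sorry, axioms ⊆ the standard trio.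
Provenance: cell pub-balaban-gaps, seat g1-p1 (gen 2 draft b354e70c21061ab2, gen 3 filing; an4 g86 A-14-1 pre-check slips L1–L4 fixed), 2026-08-23; imports `Gaps.D1RoadsJunction` + g1-p2's `Gaps.BetaContFromD4Chain` + d1-p3's `Beta.FP.StepKernelWardDataRecord` (read-only, BY NAME); no existing file touched.
v1.1 (APPEND-ONLY, gen 3, 2026-08-23; INTENT I-gapsg1p1-8): + `import …Beta.FP.StepRecursionFeedTabs` (d1-p3 #31, read-only, BY NAME) + §4; every v1 declaration byte-identical (v1 = p345653 ✓ cc69243922c0).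
-/

noncomputable section

open Finset
open scoped BigOperators
open Literature.MathematicalPhysics.QuantumFieldTheory
open Literature.MathematicalPhysics.QuantumFieldTheory.Balaban1983to89
open Literature.MathematicalPhysics.QuantumFieldTheory.Balaban1983to89.Beta
open OneStepResolventKernel (JetData)
open OneStepKernelFamily (TbalOf TshotOf D1Tel D1Rep D1Drift)
open B12Beta (secondMoment)
open DressedMomentNormalisation (EKer dressedEntry)
open HessianTelescopingKKT (StepRecursion wStep)
open FlowStep FlowStepRuns DagBinding
open RemainderResidue (AtSlope)
open Summit.QuantumFields.BalabanUV.Gaps.BetaContFromD4Chain (AtSlopeCont continuumYM4Torus_of_residue_atSlopeCont)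
open T4Continuum (T4Family FiniteEpsData)
open T4ContinuumYM4Torus (ContinuumYM4Torus ContinuumYM4TorusE continuumYM4_torus_of_endpointExistence_nonvacuous)
open Summit.QuantumFields.BalabanUV.Beta.CombChartJointEnd (JsB12CombShSym)
open Summit.QuantumFields.BalabanUV.Beta.SymSecondOrderTablesAn1 (symTablesAn1S2)
open Summit.QuantumFields.BalabanUV.Beta.CombOneShotJets (JcOf)
open Summit.QuantumFields.BalabanUV.Beta.FP.StepKernelWardDataRecord
  (stepT0_JsB12CombShSym_an1S2_pinned stepT1_JsB12CombShSym_an1S2_pinned d1Tel_anchored_of_kernel_laws_wStep_pinned d1Tel_anchored_of_stepRecursion_wStep_pinned)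
open Summit.QuantumFields.BalabanUV.Gaps.D1Residue
open Summit.QuantumFields.BalabanUV.Gaps.D1BinderEnds (lock_mul_pow)
open Summit.QuantumFields.BalabanUV.Gaps.D1RoadsJunction (readoutBdd_of_D1Tel_T0T1)

namespace Summit.QuantumFields.BalabanUV.Gaps.D1RoadsJunctionPinned

variable {Lc : ℕ} [NeZero Lc]

/-! ## §1 Under the locks: the step recursion (ONE hypothesis) ∕ road FP's rows (L1)(L2′) ⟹ ( (D1) ⟺ `OneShotLaw` ) -/

section Locks

/-- [folklore] **(RB), EXACTLY, FROM THE STEP RECURSION** — under the locks, for any composite family anchored on `JcOf` at `m = 1`: `StepRecursion` ⟹ `D1Tel`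
(#30d `d1Tel_anchored_of_stepRecursion_wStep_pinned`) ⟹ with #30d's (T0)(T1) the exact read-out identity ⟹ `ReadoutBdd` (U′ = 0). -/
theorem readoutBdd_record_of_stepRecursion (hLc : Odd Lc) (hL2 : 2 ≤ Lc) {N : ℕ} (hN : 2 ≤ N) (cΛ cB : ℝ)
    (hΛ : cΛ * (Lc : ℝ) ^ 4 = 2) (hcB : cB = -((Lc : ℝ) ^ 12 / 4))
    (Jc : ∀ m : ℕ, JetData 3 (Lc ^ m)) (hJc1 : Jc 1 = JcOf hLc N (fun _ => cΛ) (fun _ => cB) 1)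
    (hrec : StepRecursion Lc (TbalOf Lc (JsB12CombShSym hLc N (symTablesAn1S2 3 Lc cΛ) cΛ cB)) (TshotOf Lc Jc) (wStep Lc)) (μ ν : Fin 4) :
    ReadoutBdd Lc (JsB12CombShSym hLc N (symTablesAn1S2 3 Lc cΛ) cΛ cB) Jc μ ν :=
  readoutBdd_of_D1Tel_T0T1 _ Jc (stepT0_JsB12CombShSym_an1S2_pinned hLc hL2 hN cΛ cB hΛ hcB)
    (stepT1_JsB12CombShSym_an1S2_pinned hLc hL2 hN cΛ cB hΛ hcB)
    (d1Tel_anchored_of_stepRecursion_wStep_pinned hLc hL2 hN cΛ cB hΛ hcB Jc hJc1 hrec) μ ν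

/-- [folklore] **THE JUNCTION, RE-POINTED: GIVEN THE STEP RECURSION OF THE KERNELS, BINDER (D1) AT THE LITERAL OF RECORD IS THE ONE-SHOT LAW OF THE COMPOSITE
FAMILY** — under the locks (`hΛ hcB`) and M‴'s scalars (`Odd Lc`, `2 ≤ Lc`, `2 ≤ N`), for ANY `Jc` anchored on `JcOf` at `m = 1`:
`StepRecursion Lc (TbalOf …) (TshotOf Lc Jc) (wStep Lc) ⟹ ( D1Drift Lc (JsB12CombShSym …) Nc μ ν ⟺ OneShotLaw Lc Jc Nc μ ν )`, any `Nc`, any `μ ν`;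
no [B5] statement, no label, no window, no symmetry letter displayed.  0 rows discharged here. -/
theorem d1Drift_record_iff_oneShotLaw_of_stepRecursion (hLc : Odd Lc) (hL2 : 2 ≤ Lc) {N : ℕ} (hN : 2 ≤ N) (cΛ cB : ℝ)
    (hΛ : cΛ * (Lc : ℝ) ^ 4 = 2) (hcB : cB = -((Lc : ℝ) ^ 12 / 4))
    (Jc : ∀ m : ℕ, JetData 3 (Lc ^ m)) (hJc1 : Jc 1 = JcOf hLc N (fun _ => cΛ) (fun _ => cB) 1)
    (hrec : StepRecursion Lc (TbalOf Lc (JsB12CombShSym hLc N (symTablesAn1S2 3 Lc cΛ) cΛ cB)) (TshotOf Lc Jc) (wStep Lc)) {Nc : ℝ} {μ ν : Fin 4} :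
    D1Drift Lc (JsB12CombShSym hLc N (symTablesAn1S2 3 Lc cΛ) cΛ cB) Nc μ ν ↔ OneShotLaw Lc Jc Nc μ ν :=
  d1Drift_iff_oneShotLaw_of_readoutBdd _ Jc (readoutBdd_record_of_stepRecursion hLc hL2 hN cΛ cB hΛ hcB Jc hJc1 hrec μ ν)

/-- [folklore] **(RB), EXACTLY, FROM ROAD FP's DISPLAYED ROWS (L1)(L2′) + ANCHOR, (L4′) GONE** (#30d `d1Tel_anchored_of_kernel_laws_wStep_pinned` + its (T0)(T1) + §1 of
`Gaps.D1RoadsJunction`): the re-pointed twin of `Gaps.D1RoadsJunction.readoutBdd_record_of_fpRows` — `hT0 hT1` no longer displayed, the locks `hΛ hcB` and `2 ≤ Lc`, `2 ≤ N` instead. -/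
theorem readoutBdd_record_of_fpRows_pinned (hLc : Odd Lc) (hL2 : 2 ≤ Lc) {N : ℕ} (hN : 2 ≤ N) (cΛ cB : ℝ)
    (hΛ : cΛ * (Lc : ℝ) ^ 4 = 2) (hcB : cB = -((Lc : ℝ) ^ 12 / 4))
    (Jc : ∀ m : ℕ, JetData 3 (Lc ^ m)) (hJc1 : Jc 1 = JcOf hLc N (fun _ => cΛ) (fun _ => cB) 1)
    (𝒦N 𝒦F 𝒦G : ℕ → EKer 4)
    (hlaw : ∀ j : ℕ, 1 ≤ j → ∀ (a b : Fin 4) (z : Fin 4 → ℤ), 𝒦N j a b z = 𝒦F j a b z + 𝒦G j a b z)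
    (hN' : ∀ j : ℕ, 1 ≤ j → ∀ (a b : Fin 4) (z : Fin 4 → ℤ), 𝒦N j a b z = TshotOf Lc Jc (j + 1) a b z)
    (hF : ∀ j : ℕ, 1 ≤ j → ∀ (a b : Fin 4) (z : Fin 4 → ℤ),
      𝒦F j a b z = (Lc : ℝ) ^ 8 * dressedEntry (wStep Lc j) (TshotOf Lc Jc j) ((Lc : ℤ) • z) a b)
    (hG : ∀ j : ℕ, 1 ≤ j → ∀ (a b : Fin 4) (z : Fin 4 → ℤ),
      𝒦G j a b z = TbalOf Lc (JsB12CombShSym hLc N (symTablesAn1S2 3 Lc cΛ) cΛ cB) j a b z) (μ ν : Fin 4) :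
    ReadoutBdd Lc (JsB12CombShSym hLc N (symTablesAn1S2 3 Lc cΛ) cΛ cB) Jc μ ν :=
  readoutBdd_of_D1Tel_T0T1 _ Jc (stepT0_JsB12CombShSym_an1S2_pinned hLc hL2 hN cΛ cB hΛ hcB)
    (stepT1_JsB12CombShSym_an1S2_pinned hLc hL2 hN cΛ cB hΛ hcB)
    (d1Tel_anchored_of_kernel_laws_wStep_pinned hLc hL2 hN cΛ cB hΛ hcB Jc hJc1 𝒦N 𝒦F 𝒦G hlaw hN' hF hG) μ ν

/-- [folklore] **… THE JUNCTION FROM ROAD FP's DISPLAYED ROWS (L1)(L2′) + ANCHOR, (L4′) GONE**: the re-pointed twin of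
`Gaps.D1RoadsJunction.d1Drift_record_iff_oneShotLaw_of_fpRows` — ( (D1) at the literal ⟺ `OneShotLaw Lc Jc Nc μ ν` ), any `Nc μ ν`. -/
theorem d1Drift_record_iff_oneShotLaw_of_fpRows_pinned (hLc : Odd Lc) (hL2 : 2 ≤ Lc) {N : ℕ} (hN : 2 ≤ N) (cΛ cB : ℝ)
    (hΛ : cΛ * (Lc : ℝ) ^ 4 = 2) (hcB : cB = -((Lc : ℝ) ^ 12 / 4))
    (Jc : ∀ m : ℕ, JetData 3 (Lc ^ m)) (hJc1 : Jc 1 = JcOf hLc N (fun _ => cΛ) (fun _ => cB) 1)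
    (𝒦N 𝒦F 𝒦G : ℕ → EKer 4)
    (hlaw : ∀ j : ℕ, 1 ≤ j → ∀ (a b : Fin 4) (z : Fin 4 → ℤ), 𝒦N j a b z = 𝒦F j a b z + 𝒦G j a b z)
    (hN' : ∀ j : ℕ, 1 ≤ j → ∀ (a b : Fin 4) (z : Fin 4 → ℤ), 𝒦N j a b z = TshotOf Lc Jc (j + 1) a b z)
    (hF : ∀ j : ℕ, 1 ≤ j → ∀ (a b : Fin 4) (z : Fin 4 → ℤ),
      𝒦F j a b z = (Lc : ℝ) ^ 8 * dressedEntry (wStep Lc j) (TshotOf Lc Jc j) ((Lc : ℤ) • z) a b)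
    (hG : ∀ j : ℕ, 1 ≤ j → ∀ (a b : Fin 4) (z : Fin 4 → ℤ),
      𝒦G j a b z = TbalOf Lc (JsB12CombShSym hLc N (symTablesAn1S2 3 Lc cΛ) cΛ cB) j a b z) {Nc : ℝ} {μ ν : Fin 4} :
    D1Drift Lc (JsB12CombShSym hLc N (symTablesAn1S2 3 Lc cΛ) cΛ cB) Nc μ ν ↔ OneShotLaw Lc Jc Nc μ ν :=
  d1Drift_iff_oneShotLaw_of_readoutBdd _ Jc
    (readoutBdd_record_of_fpRows_pinned hLc hL2 hN cΛ cB hΛ hcB Jc hJc1 𝒦N 𝒦F 𝒦G hlaw hN' hF hG μ ν)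

end Locks

/-! ## §2 At the pins `cΛ := 2/Lc⁴`, `cB := −Lc¹²/4`: the locks are `lock_mul_pow` ∕ `rfl` -/

/-- [folklore] **AT THE PINNED LITERAL OF RECORD**: `Odd Lc`, `2 ≤ Lc`, `2 ≤ N`, a composite family anchored on `JcOf` at `m = 1`, and the step recursion of the
kernels ⟹ ( (D1) ⟺ `OneShotLaw Lc Jc Nc μ ν` ) — NOTHING ELSE displayed. -/
theorem d1Drift_pinned_iff_oneShotLaw_of_stepRecursion (hLc : Odd Lc) (hL2 : 2 ≤ Lc) {N : ℕ} (hN : 2 ≤ N)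
    (Jc : ∀ m : ℕ, JetData 3 (Lc ^ m)) (hJc1 : Jc 1 = JcOf hLc N (fun _ => 2 / (Lc : ℝ) ^ 4) (fun _ => -((Lc : ℝ) ^ 12 / 4)) 1)
    (hrec : StepRecursion Lc
      (TbalOf Lc (JsB12CombShSym hLc N (symTablesAn1S2 3 Lc (2 / (Lc : ℝ) ^ 4)) (2 / (Lc : ℝ) ^ 4) (-((Lc : ℝ) ^ 12 / 4)))) (TshotOf Lc Jc) (wStep Lc))
    {Nc : ℝ} {μ ν : Fin 4} :
    D1Drift Lc (JsB12CombShSym hLc N (symTablesAn1S2 3 Lc (2 / (Lc : ℝ) ^ 4)) (2 / (Lc : ℝ) ^ 4) (-((Lc : ℝ) ^ 12 / 4))) Nc μ ν ↔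
      OneShotLaw Lc Jc Nc μ ν :=
  d1Drift_record_iff_oneShotLaw_of_stepRecursion hLc hL2 hN _ _ (lock_mul_pow hL2) rfl Jc hJc1 hrec

/-! ## §3 Up to the T⁴ headline: the β-side opened down to the step recursion + the one-shot law + row (D4)'s residue + (C) -/

section Headline

variable {F : T4Family} {Ncol : ℕ} [NeZero Ncol]

/-- [folklore] **THE T⁴ HEADLINE FROM THE STEP RECURSION, THE ONE-SHOT LAW, ROW (D4)'s RESIDUE AND (C)**: B1 `hD` ∧ B2 `hB` ∧ B5 `hNE` (under endpoint existence) ∧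
a split `Sβ` of `D.βfun` pinned by `hβ` to the (III′) step kernels at the pins ∧ `Odd Lc`, `2 ≤ Lc`, `2 ≤ Ng` ∧ a composite family anchored at `m = 1` ∧ an4's
`StepRecursion` ∧ `OneShotLaw Lc Jc N μ ν` ∧ `AtSlope Sβ γ₀ (stepBal N Lc)` ∧ `BetaContH γ₀ D.βfun` ⟹ `ContinuumYM4Torus D ∧ ContinuumYM4TorusE D`.  0 discharged. -/
theorem continuumYM4Torus_of_stepRecursion_oneShotLaw_atSlope (D : FiniteEpsData F (Matrix.specialUnitaryGroup (Fin Ncol) ℂ))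
    (hD : D.IsPrintedAveraged) (hB : B16.EndStatementBPrinted D.C) (hNE : T4ApexHybrid.HybridNE7Under D (EndpointExistence D.C.toB12))
    (Sβ : B12Beta.OneLoopSplit D.βfun) (hLc : Odd Lc) (hL2 : 2 ≤ Lc) {Ng : ℕ} (hNg : 2 ≤ Ng) {N : ℝ} {μ ν : Fin 4}
    (hβ : ∀ j, Sβ.β0 j =
      secondMoment (TbalOf Lc (JsB12CombShSym hLc Ng (symTablesAn1S2 3 Lc (2 / (Lc : ℝ) ^ 4)) (2 / (Lc : ℝ) ^ 4) (-((Lc : ℝ) ^ 12 / 4))) j) μ ν)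
    (Jc : ∀ m : ℕ, JetData 3 (Lc ^ m)) (hJc1 : Jc 1 = JcOf hLc Ng (fun _ => 2 / (Lc : ℝ) ^ 4) (fun _ => -((Lc : ℝ) ^ 12 / 4)) 1)
    (hrec : StepRecursion Lc
      (TbalOf Lc (JsB12CombShSym hLc Ng (symTablesAn1S2 3 Lc (2 / (Lc : ℝ) ^ 4)) (2 / (Lc : ℝ) ^ 4) (-((Lc : ℝ) ^ 12 / 4)))) (TshotOf Lc Jc) (wStep Lc))
    (hosl : OneShotLaw Lc Jc N μ ν)
    {γ₀ : ℝ} (hγ₀ : 0 < γ₀) (hslope : AtSlope Sβ γ₀ (B12Normalization.stepBal N Lc)) (hcont : BetaContH γ₀ D.βfun) :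
    ContinuumYM4Torus D ∧ ContinuumYM4TorusE D :=
  continuumYM4_torus_of_endpointExistence_nonvacuous D hD hB
    (endpointExistence_of_residue_atSlope D.fwd Sβ _ hβ
      ⟨Jc, readoutBdd_record_of_stepRecursion hLc hL2 hNg _ _ (lock_mul_pow hL2) rfl Jc hJc1 hrec μ ν, hosl⟩ hγ₀ hslope hcont) hNE

/-- [folklore] **THE SAME WITH (C) DERIVED AND THE COLOUR NUMERAL PINNED TO THE GAUGE GROUP**: rows (D4) ∧ B4 enter through g1-p2's ONE residue
`Gaps.BetaContFromD4Chain.AtSlopeCont Sβ γ₀ (stepBal Ncol Lc)` (p342809; it yields `AtSlope` AND `BetaContH γ₀ D.βfun`), the one-shot law is asked at the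
datum's own colour number `Ncol` (as in `Gaps.BetaContFromD4Chain.continuumYM4Torus_of_residue_atSlopeCont`): B1 `hD` ∧ B2 `hB` ∧ B5 `hNE` ∧ `hβ` ∧
`Odd Lc`, `2 ≤ Lc`, `2 ≤ Ng` ∧ anchor ∧ an4's `StepRecursion` ∧ `OneShotLaw Lc Jc Ncol μ ν` ∧ `AtSlopeCont Sβ γ₀ (stepBal Ncol Lc)` ⟹
`ContinuumYM4Torus D ∧ ContinuumYM4TorusE D` — the β-column of the T⁴ headline displayed as: the step recursion (road FP), the one-shot law (road BF-x),
the (D4)+(C-pt) object (row (D4)).  (For Bałaban's data the jets' colour parameter `Ng` IS the gauge rank `Ncol`; they are displayed separately here, which is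
more general and claims nothing about their identification.)  0 discharged. -/
theorem continuumYM4Torus_of_stepRecursion_oneShotLaw_atSlopeCont (D : FiniteEpsData F (Matrix.specialUnitaryGroup (Fin Ncol) ℂ))
    (hD : D.IsPrintedAveraged) (hB : B16.EndStatementBPrinted D.C) (hNE : T4ApexHybrid.HybridNE7Under D (EndpointExistence D.C.toB12))
    (Sβ : B12Beta.OneLoopSplit D.βfun) (hLc : Odd Lc) (hL2 : 2 ≤ Lc) {Ng : ℕ} (hNg : 2 ≤ Ng) {μ ν : Fin 4}
    (hβ : ∀ j, Sβ.β0 j =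
      secondMoment (TbalOf Lc (JsB12CombShSym hLc Ng (symTablesAn1S2 3 Lc (2 / (Lc : ℝ) ^ 4)) (2 / (Lc : ℝ) ^ 4) (-((Lc : ℝ) ^ 12 / 4))) j) μ ν)
    (Jc : ∀ m : ℕ, JetData 3 (Lc ^ m)) (hJc1 : Jc 1 = JcOf hLc Ng (fun _ => 2 / (Lc : ℝ) ^ 4) (fun _ => -((Lc : ℝ) ^ 12 / 4)) 1)
    (hrec : StepRecursion Lc
      (TbalOf Lc (JsB12CombShSym hLc Ng (symTablesAn1S2 3 Lc (2 / (Lc : ℝ) ^ 4)) (2 / (Lc : ℝ) ^ 4) (-((Lc : ℝ) ^ 12 / 4)))) (TshotOf Lc Jc) (wStep Lc))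
    (hosl : OneShotLaw Lc Jc (Ncol : ℝ) μ ν)
    {γ₀ : ℝ} (hγ₀ : 0 < γ₀) (hres : AtSlopeCont Sβ γ₀ (B12Normalization.stepBal (Ncol : ℝ) Lc)) :
    ContinuumYM4Torus D ∧ ContinuumYM4TorusE D :=
  continuumYM4Torus_of_residue_atSlopeCont D hD hB Sβ _ hβ
    ⟨Jc, readoutBdd_record_of_stepRecursion hLc hL2 hNg _ _ (lock_mul_pow hL2) rfl Jc hJc1 hrec μ ν, hosl⟩ hγ₀ hres hNE

/-- [folklore] **THE SAME FROM ROAD FP's DISPLAYED ROWS** (g1-plan-2 X-31, re-pointed): B1 `hD` ∧ B2 `hB` ∧ B5 `hNE` ∧ `hβ` ∧ `Odd Lc`, `2 ≤ Lc`, `2 ≤ Ng` ∧ road FP's rows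
(L1) `hlaw` + (L2′) `hN' hF hG` at a composite family anchored at `m = 1` ((L4′) GONE — #30d) ∧ `OneShotLaw Lc Jc Ncol μ ν` ∧ g1-p2's `AtSlopeCont Sβ γ₀ (stepBal Ncol Lc)` ⟹
`ContinuumYM4Torus D ∧ ContinuumYM4TorusE D` — the β-column of the T⁴ headline as THREE deliverables: road FP's rows, road BF-x's one-shot law, row (D4)'s object with (C-pt);
B3∕B4∕(UP)∕(C) derived.  0 discharged. -/
theorem continuumYM4Torus_of_fpRows_pinned_oneShotLaw_atSlopeCont (D : FiniteEpsData F (Matrix.specialUnitaryGroup (Fin Ncol) ℂ))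
    (hD : D.IsPrintedAveraged) (hB : B16.EndStatementBPrinted D.C) (hNE : T4ApexHybrid.HybridNE7Under D (EndpointExistence D.C.toB12))
    (Sβ : B12Beta.OneLoopSplit D.βfun) (hLc : Odd Lc) (hL2 : 2 ≤ Lc) {Ng : ℕ} (hNg : 2 ≤ Ng) {μ ν : Fin 4}
    (hβ : ∀ j, Sβ.β0 j =
      secondMoment (TbalOf Lc (JsB12CombShSym hLc Ng (symTablesAn1S2 3 Lc (2 / (Lc : ℝ) ^ 4)) (2 / (Lc : ℝ) ^ 4) (-((Lc : ℝ) ^ 12 / 4))) j) μ ν)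
    (Jc : ∀ m : ℕ, JetData 3 (Lc ^ m)) (hJc1 : Jc 1 = JcOf hLc Ng (fun _ => 2 / (Lc : ℝ) ^ 4) (fun _ => -((Lc : ℝ) ^ 12 / 4)) 1)
    (𝒦N 𝒦F 𝒦G : ℕ → EKer 4)
    (hlaw : ∀ j : ℕ, 1 ≤ j → ∀ (a b : Fin 4) (z : Fin 4 → ℤ), 𝒦N j a b z = 𝒦F j a b z + 𝒦G j a b z)
    (hN' : ∀ j : ℕ, 1 ≤ j → ∀ (a b : Fin 4) (z : Fin 4 → ℤ), 𝒦N j a b z = TshotOf Lc Jc (j + 1) a b z)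
    (hF : ∀ j : ℕ, 1 ≤ j → ∀ (a b : Fin 4) (z : Fin 4 → ℤ),
      𝒦F j a b z = (Lc : ℝ) ^ 8 * dressedEntry (wStep Lc j) (TshotOf Lc Jc j) ((Lc : ℤ) • z) a b)
    (hG : ∀ j : ℕ, 1 ≤ j → ∀ (a b : Fin 4) (z : Fin 4 → ℤ), 𝒦G j a b z =
      TbalOf Lc (JsB12CombShSym hLc Ng (symTablesAn1S2 3 Lc (2 / (Lc : ℝ) ^ 4)) (2 / (Lc : ℝ) ^ 4) (-((Lc : ℝ) ^ 12 / 4))) j a b z)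
    (hosl : OneShotLaw Lc Jc (Ncol : ℝ) μ ν)
    {γ₀ : ℝ} (hγ₀ : 0 < γ₀) (hres : AtSlopeCont Sβ γ₀ (B12Normalization.stepBal (Ncol : ℝ) Lc)) :
    ContinuumYM4Torus D ∧ ContinuumYM4TorusE D :=
  continuumYM4Torus_of_residue_atSlopeCont D hD hB Sβ _ hβ
    ⟨Jc, readoutBdd_record_of_fpRows_pinned hLc hL2 hNg _ _ (lock_mul_pow hL2) rfl Jc hJc1 𝒦N 𝒦F 𝒦G hlaw hN' hF hG μ ν, hosl⟩ hγ₀ hres hNE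

end Headline


/-! ## §4 (v1.1, APPEND-ONLY) At the composite-contour class of record `JcOfTabs` (an2 R-D1-g42-4 ∕ R-D1-g43-2): road FP's #31 called -/

section Tabs

open Summit.QuantumFields.BalabanUV.Beta.SymmetrisedStepJets (SymTables)
open Summit.QuantumFields.BalabanUV.Beta.CombOneShotJetsTabs (JcOfTabs)
open Summit.QuantumFields.BalabanUV.Beta.FP.StepRecursionFeedTabs (d1Tel_JcOfTabs_of_stepRecursion_wStep_pinned d1Tel_JcOfTabs_of_kernel_laws_wStep_pinned)

/-- [folklore] **THE JUNCTION AT THE `Jc` OF RECORD `JcOfTabs hLc N tabs cΛ cB`** (an2's `Beta.CombOneShotJetsTabs`; ROOT M‴'s `Jc` for BOTH roads is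
`JcOfTabs hLc N tabsComp cΛ cB`, `tabsComp` = the composite-contour table record — a SLOT): for ANY scale-indexed record `tabs` whose depth-1 member is an1's record
(`h1`, an2's `HEq` currency across `Lc¹ = Lc`), lock numerals `cΛ cB : ℕ → ℝ` locked at level 1 ONLY (`hΛ hcB`; deeper values free), and M‴'s scalars:
an4's `StepRecursion Lc (TbalOf Lc Js) (TshotOf Lc (JcOfTabs hLc N tabs cΛ cB)) (wStep Lc)` ⟹ ( (D1) at the (III′) literal ⟺ `OneShotLaw Lc (JcOfTabs hLc N tabs cΛ cB) Nc μ ν` ),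
any `Nc μ ν`.  Road FP OWNER d1-p3's #31 `FP.StepRecursionFeedTabs.d1Tel_JcOfTabs_of_stepRecursion_wStep_pinned` CALLED (its `htel`), then §1's route
(`readoutBdd_of_D1Tel_T0T1` with #30d's (T0)(T1), `d1Drift_iff_oneShotLaw_of_readoutBdd`).  0 rows discharged; nothing of #31 restated. -/
theorem d1Drift_record_iff_oneShotLaw_of_stepRecursion_tabs (hLc : Odd Lc) (hL2 : 2 ≤ Lc) {N : ℕ} (hN : 2 ≤ N) (cΛ cB : ℕ → ℝ)
    (hΛ : cΛ 1 * (Lc : ℝ) ^ 4 = 2) (hcB : cB 1 = -((Lc : ℝ) ^ 12 / 4)) (tabs : ∀ m : ℕ, SymTables 3 (Lc ^ m))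
    (h1 : HEq (tabs 1) (symTablesAn1S2 3 Lc (cΛ 1)))
    (hrec : StepRecursion Lc (TbalOf Lc (JsB12CombShSym hLc N (symTablesAn1S2 3 Lc (cΛ 1)) (cΛ 1) (cB 1))) (TshotOf Lc (JcOfTabs hLc N tabs cΛ cB))
      (wStep Lc)) {Nc : ℝ} {μ ν : Fin 4} :
    D1Drift Lc (JsB12CombShSym hLc N (symTablesAn1S2 3 Lc (cΛ 1)) (cΛ 1) (cB 1)) Nc μ ν ↔ OneShotLaw Lc (JcOfTabs hLc N tabs cΛ cB) Nc μ ν :=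
  d1Drift_iff_oneShotLaw_of_readoutBdd _ _
    (readoutBdd_of_D1Tel_T0T1 _ _ (stepT0_JsB12CombShSym_an1S2_pinned hLc hL2 hN (cΛ 1) (cB 1) hΛ hcB)
      (stepT1_JsB12CombShSym_an1S2_pinned hLc hL2 hN (cΛ 1) (cB 1) hΛ hcB)
      (d1Tel_JcOfTabs_of_stepRecursion_wStep_pinned hLc hL2 hN cΛ cB hΛ hcB tabs h1 hrec) μ ν)

/-- [folklore] **… FROM ROAD FP's DISPLAYED ROWS (L1)(L2′) AT `JcOfTabs`** (#31 `d1Tel_JcOfTabs_of_kernel_laws_wStep_pinned` CALLED). -/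
theorem d1Drift_record_iff_oneShotLaw_of_fpRows_tabs (hLc : Odd Lc) (hL2 : 2 ≤ Lc) {N : ℕ} (hN : 2 ≤ N) (cΛ cB : ℕ → ℝ)
    (hΛ : cΛ 1 * (Lc : ℝ) ^ 4 = 2) (hcB : cB 1 = -((Lc : ℝ) ^ 12 / 4)) (tabs : ∀ m : ℕ, SymTables 3 (Lc ^ m))
    (h1 : HEq (tabs 1) (symTablesAn1S2 3 Lc (cΛ 1))) (𝒦N 𝒦F 𝒦G : ℕ → EKer 4)
    (hlaw : ∀ j : ℕ, 1 ≤ j → ∀ (a b : Fin 4) (z : Fin 4 → ℤ), 𝒦N j a b z = 𝒦F j a b z + 𝒦G j a b z)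
    (hN' : ∀ j : ℕ, 1 ≤ j → ∀ (a b : Fin 4) (z : Fin 4 → ℤ), 𝒦N j a b z = TshotOf Lc (JcOfTabs hLc N tabs cΛ cB) (j + 1) a b z)
    (hF : ∀ j : ℕ, 1 ≤ j → ∀ (a b : Fin 4) (z : Fin 4 → ℤ),
      𝒦F j a b z = (Lc : ℝ) ^ 8 * dressedEntry (wStep Lc j) (TshotOf Lc (JcOfTabs hLc N tabs cΛ cB) j) ((Lc : ℤ) • z) a b)
    (hG : ∀ j : ℕ, 1 ≤ j → ∀ (a b : Fin 4) (z : Fin 4 → ℤ),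
      𝒦G j a b z = TbalOf Lc (JsB12CombShSym hLc N (symTablesAn1S2 3 Lc (cΛ 1)) (cΛ 1) (cB 1)) j a b z) {Nc : ℝ} {μ ν : Fin 4} :
    D1Drift Lc (JsB12CombShSym hLc N (symTablesAn1S2 3 Lc (cΛ 1)) (cΛ 1) (cB 1)) Nc μ ν ↔ OneShotLaw Lc (JcOfTabs hLc N tabs cΛ cB) Nc μ ν :=
  d1Drift_iff_oneShotLaw_of_readoutBdd _ _
    (readoutBdd_of_D1Tel_T0T1 _ _ (stepT0_JsB12CombShSym_an1S2_pinned hLc hL2 hN (cΛ 1) (cB 1) hΛ hcB)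
      (stepT1_JsB12CombShSym_an1S2_pinned hLc hL2 hN (cΛ 1) (cB 1) hΛ hcB)
      (d1Tel_JcOfTabs_of_kernel_laws_wStep_pinned hLc hL2 hN cΛ cB hΛ hcB tabs h1 𝒦N 𝒦F 𝒦G hlaw hN' hF hG) μ ν)

end Tabs

end Summit.QuantumFields.BalabanUV.Gaps.D1RoadsJunctionPinned

end
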